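import Literature.MathematicalPhysics.QuantumManyBody.BoseGasThermodynamicLimitRuelle
import Literature.MathematicalPhysics.QuantumManyBody.BoseGasDirichletWall
import HarnessLib

/-!
# `BecUvTail` (stmt-AtomisticToContinuum-8823), line `Sketch` — registered stub `stub_tailArithmetic`

Helper for the crux skeleton `Cruxes/BecUvTail/Lines/Sketch.lean` of route `BECInfraredBound`
(`AtomisticToContinuum/BoseEinsteinCondensation`): proves the registered stub `stub_tailArithmetic` verbatim.
This is the purely arithmetic closing step of the ultraviolet-tail estimate: GIVEN the lifted
one-body tail bound (a hypothesis here; it is the neighbouring stub `stub_liftOneBody`)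
`Σ_{‖k‖ > K'} ⟨w_k, γ_Ψ w_k⟩ ≤ c₀ N + A ((1-2ε)L/K')² T(Ψ)` for the window modes `w_k` of the box of
side `L`, with `c₀ < 1`, and the kinetic budget `T(Ψ) ≤ C ρ N` in the thermodynamic box
`L = L_N(ρ) = (N/ρ)^{1/3}`, we choose the cutoff scale `K' = K √ρ L` with
`K = √(2AC/(1-c₀)) + 1` and obtain `Σ_{‖k‖ > K √ρ L} ⟨w_k, γ_Ψ w_k⟩ ≤ θ N` with
`θ = (1 + c₀)/2 < 1`, eventually in `N` (namely as soon as `N ≥ 1` and `K √ρ L_N(ρ) ≥ M`, which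
holds for large `N` because `L_N(ρ) → ∞`).  The side `L` cancels in `(1-2ε)L/K'`, the factor
`(1-2ε)² ≤ 1` is dropped, and `A C/K² ≤ (1-c₀)/2` by the choice of `K`; the remaining work is
moving between `ℝ` and `ℝ≥0∞` (`ENNReal.ofReal_mul`, `ENNReal.ofReal_add`,
`ENNReal.ofReal_natCast`).  Elementary; no source needed (folklore bookkeeping in the style of
Lieb–Seiringer–Solovej–Yngvason, *The Mathematics of the Bose Gas and its Condensation*, 2005).
-/

noncomputable section

open MeasureTheory Filter
open scoped ENNReal NNReal BigOperators

namespace Summit.AtomisticToContinuum.BoseEinsteinCondensation.Theorems.BecUvTail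

open Literature.MathematicalPhysics.QuantumManyBody.BoseGas

/-- Choice of the cutoff constant: with `K = √(2AC/(1-c₀)) + 1` one has `2AC ≤ (1 - c₀) K²`
(since `2AC/(1-c₀) = (√(2AC/(1-c₀)))² ≤ (√(2AC/(1-c₀)) + 1)²`). [folklore] -/
private theorem two_mul_mul_le_K_sq {c₀ A C : ℝ} (hc₁ : c₀ < 1) (hA : 0 ≤ A) (hC : 0 < C) :
    2 * A * C ≤ (1 - c₀) * (Real.sqrt (2 * A * C / (1 - c₀)) + 1) ^ 2 := by
  have h1c : 0 < 1 - c₀ := sub_pos.2 hc₁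
  have hx : 0 ≤ 2 * A * C / (1 - c₀) :=
    div_nonneg (mul_nonneg (mul_nonneg zero_le_two hA) hC.le) h1c.le
  have h1 : 2 * A * C / (1 - c₀) ≤ (Real.sqrt (2 * A * C / (1 - c₀)) + 1) ^ 2 := by
    nlinarith [Real.sq_sqrt hx, Real.sqrt_nonneg (2 * A * C / (1 - c₀))]
  rw [div_le_iff₀ h1c] at h1
  linarith [h1]

/-- The real arithmetic behind the tail estimate: with `K' = K √ρ L` the side `L` cancels,
`A ((1-2ε)L/K')² · Cρm = A C (1-2ε)² m / K² ≤ A C m / K² ≤ (1-c₀)/2 · m` (using `(1-2ε)² ≤ 1`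
for `0 < ε < 1/4` and `2AC ≤ (1-c₀)K²`), whence
`c₀ m + A ((1-2ε)L/K')² · Cρm ≤ (1+c₀)/2 · m` for `m ≥ 0`. [folklore] -/
private theorem tail_real_bound {c₀ A C K ε ρ L m : ℝ} (hc₁ : c₀ < 1) (hC : 0 < C) (hK : 0 < K) (hKsq : 2 * A * C ≤ (1 - c₀) * K ^ 2) (hε : 0 < ε) (hε4 : ε < 1 / 4)
    (hρ : 0 < ρ) (hL : 0 < L) (hm : 0 ≤ m) :
    c₀ * m + A * ((1 - 2 * ε) * L / (K * Real.sqrt ρ * L)) ^ 2 * (C * ρ * m) ≤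
      (1 + c₀) / 2 * m := by
  have hKne : K ≠ 0 := hK.ne'
  have hρne : ρ ≠ 0 := hρ.ne'
  rw [mul_div_mul_right _ _ hL.ne', div_pow, mul_pow, Real.sq_sqrt hρ.le]
  have hε' : (1 - 2 * ε) ^ 2 ≤ 1 := by nlinarith
  have hACK : A * C / K ^ 2 ≤ (1 - c₀) / 2 := by
    rw [div_le_iff₀ (pow_pos hK 2)]
    linarith
  have key : A * ((1 - 2 * ε) ^ 2 / (K ^ 2 * ρ)) * (C * ρ * m) ≤ (1 - c₀) / 2 * m :=
    calc A * ((1 - 2 * ε) ^ 2 / (K ^ 2 * ρ)) * (C * ρ * m)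
        = A * C / K ^ 2 * (1 - 2 * ε) ^ 2 * m := by
          field_simp
      _ ≤ (1 - c₀) / 2 * 1 * m :=
          mul_le_mul_of_nonneg_right (mul_le_mul hACK hε' (sq_nonneg _) (by linarith)) hm
      _ = (1 - c₀) / 2 * m := by ring
  linarith [key]

/-- Casting step: from `T ≤ ofReal b` and the real inequality `c₀ (n+1) + a b ≤ θ (n+1)`
(`c₀, a, b ≥ 0`) conclude `ofReal c₀ · (n+1) + ofReal a · T ≤ ofReal (θ (n+1))` in `ℝ≥0∞`
(`ENNReal.ofReal_mul`, `ENNReal.ofReal_add`, `ENNReal.ofReal_natCast`). [folklore] -/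
private theorem tail_cast_bound {c₀ a b θ : ℝ} {T : ℝ≥0∞} (n : ℕ) (hc₀ : 0 ≤ c₀) (ha : 0 ≤ a)
    (hb : 0 ≤ b) (hT : T ≤ ENNReal.ofReal b)
    (h : c₀ * ((n + 1 : ℕ) : ℝ) + a * b ≤ θ * ((n + 1 : ℕ) : ℝ)) :
    ENNReal.ofReal c₀ * (n + 1 : ℝ≥0∞) + ENNReal.ofReal a * T ≤
      ENNReal.ofReal (θ * ((n + 1 : ℕ) : ℝ)) :=
  calc ENNReal.ofReal c₀ * (n + 1 : ℝ≥0∞) + ENNReal.ofReal a * T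
      ≤ ENNReal.ofReal c₀ * (n + 1 : ℝ≥0∞) + ENNReal.ofReal a * ENNReal.ofReal b := by gcongr
    _ = ENNReal.ofReal (c₀ * ((n + 1 : ℕ) : ℝ) + a * b) := by
        rw [ENNReal.ofReal_add (mul_nonneg hc₀ (Nat.cast_nonneg _)) (mul_nonneg ha hb),
          ENNReal.ofReal_mul hc₀, ENNReal.ofReal_mul ha, ENNReal.ofReal_natCast, Nat.cast_succ]
    _ ≤ ENNReal.ofReal (θ * ((n + 1 : ℕ) : ℝ)) := ENNReal.ofReal_le_ofReal h

/-- **Arithmetic closing of the ultraviolet tail bound.**  Assume the lifted one-body tail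
inequality: for every box side `L > 0`, window parameter `0 < ε < 1/4`, cutoff `K' ≥ M` and
`(n+1)`-particle trial state `Ψ`,
`Σ_{‖k‖ > K'} ⟨w_k, γ_Ψ w_k⟩ ≤ c₀ (n+1) + A ((1-2ε)L/K')² ∫|∇Ψ|²` (`0 ≤ c₀ < 1`, `A ≥ 0`, `M ≥ 1`;
`w_k` the plane waves of the shrunken window `(εL, L-εL)³`).  Then for every `C > 0` there are
`K > 0` and `θ < 1` such that for all `0 < ε < 1/4`, `ρ > 0`, eventually in `N`, every
`N`-particle trial state in the thermodynamic box `L_N(ρ)` with kinetic energy `≤ C ρ N` has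
`Σ_{‖k‖ > K √ρ L_N(ρ)} ⟨w_k, γ_Ψ w_k⟩ ≤ θ N`.
Proof idea: take `K = √(2AC/(1-c₀)) + 1`, `θ = (1+c₀)/2`; eventually `N ≥ 1` and
`K √ρ L_N(ρ) ≥ M` (`L_N(ρ) → ∞`), so the hypothesis applies with `K' = K √ρ L_N(ρ)`; the side
cancels, `((1-2ε)L/K')² · Cρ = C(1-2ε)²/K² ≤ C/K²`, and `c₀ + AC/K² ≤ (1+c₀)/2` by the choice of
`K`; the rest is `ℝ ↔ ℝ≥0∞` bookkeeping (registered stub `stub_tailArithmetic` of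
stmt-AtomisticToContinuum-8823, verbatim). [folklore] -/
theorem stub_tailArithmetic :
    ∀ (c₀ A M : ℝ), 0 ≤ c₀ → c₀ < 1 → 0 ≤ A → 1 ≤ M → (∀ (n : ℕ) (L ε K' : ℝ) (Ψ : Literature.MathematicalPhysics.QuantumManyBody.BoseGas.TrialState (n + 1) L), 0 < L → 0 < ε → ε < 1 / 4 → M ≤ K' → ∑' k : {n : Fin 3 → ℤ // K' < ‖(fun j => (n j : ℝ))‖}, Literature.MathematicalPhysics.QuantumManyBody.BoseGas.occupation (n + 1) ({x : EuclideanSpace ℝ (Fin 3) | ∀ j, x j ∈ Set.Ioo (ε * L) (L - ε * L)}.indicator fun x => ((Real.sqrt (((1 - 2 * ε) * L) ^ 3))⁻¹ : ℂ) * Complex.exp (Complex.I * ↑(2 * Real.pi / ((1 - 2 * ε) * L) * ∑ j, ((k : Fin 3 → ℤ) j : ℝ) * x j))) Ψ.ψ ≤ ENNReal.ofReal c₀ * (n + 1 : ENNReal) + ENNReal.ofReal (A * ((1 - 2 * ε) * L / K') ^ 2) * ∫⁻ X, Literature.MathematicalPhysics.QuantumManyBody.BoseGas.kineticDensity Ψ.ψ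 X) → ∀ C : ℝ, 0 < C → ∃ K : ℝ, 0 < K ∧ ∃ θ : ℝ, θ < 1 ∧ ∀ ε : ℝ, 0 < ε → ε < 1 / 4 → ∀ ρ : ℝ, 0 < ρ → ∀ᶠ N : ℕ in Filter.atTop, ∀ Ψ : Literature.MathematicalPhysics.QuantumManyBody.BoseGas.TrialState N (Literature.MathematicalPhysics.QuantumManyBody.BoseGas.sideLength ρ N), (∫⁻ X, Literature.MathematicalPhysics.QuantumManyBody.BoseGas.kineticDensity Ψ.ψ X) ≤ ENNReal.ofReal (C * ρ * N) → ∑' k : {k : Fin 3 → ℤ // K * Real.sqrt ρ * Literature.MathematicalPhysics.QuantumManyBody.BoseGas.sideLength ρ N < ‖(fun j => (k j : ℝ))‖}, Literature.MathematicalPhysics.QuantumManyBody.BoseGas.occupation N ({x : EuclideanSpace ℝ (Fin 3) | ∀ j, x j ∈ Set.Ioo (ε * Literature.MathematicalPhysics.QuantumManyBody.BoseGas.sideLength ρ N) (Literature.MathematicalPhysics.QuantumManyBody.BoseGas.sideLength ρ N - ε * Literature.MathematicalPhysics.QuantumManyBody.BoseGas.sideLength ρ N)}.indicator fun x => ((Real.sqrt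 (((1 - 2 * ε) * Literature.MathematicalPhysics.QuantumManyBody.BoseGas.sideLength ρ N) ^ 3))⁻¹ : ℂ) * Complex.exp (Complex.I * ↑(2 * Real.pi / ((1 - 2 * ε) * Literature.MathematicalPhysics.QuantumManyBody.BoseGas.sideLength ρ N) * ∑ j, ((k : Fin 3 → ℤ) j : ℝ) * x j))) Ψ.ψ ≤ ENNReal.ofReal (θ * N) := by
  intro c₀ A M hc₀ hc₁ hA hM H C hC
  obtain ⟨K, hKpos, hKsq⟩ : ∃ K : ℝ, 0 < K ∧ 2 * A * C ≤ (1 - c₀) * K ^ 2 :=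
    ⟨Real.sqrt (2 * A * C / (1 - c₀)) + 1,
      add_pos_of_nonneg_of_pos (Real.sqrt_nonneg _) one_pos, two_mul_mul_le_K_sq hc₁ hA hC⟩
  refine ⟨K, hKpos, (1 + c₀) / 2, by linarith, ?_⟩
  intro ε hε hε4 ρ hρ
  have hsρ : 0 < Real.sqrt ρ := Real.sqrt_pos.2 hρ
  filter_upwards [eventually_ge_atTop 1,
    (tendsto_sideLength_atTop hρ).eventually_ge_atTop (M / (K * Real.sqrt ρ))] with N hN1 hN2 Ψ hT
  obtain ⟨n, rfl⟩ : ∃ n, N = n + 1 := ⟨N - 1, by omega⟩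
  have hLpos : 0 < sideLength ρ (n + 1) := sideLength_pos_of_pos hρ (Nat.succ_pos n)
  have hMK : M ≤ K * Real.sqrt ρ * sideLength ρ (n + 1) :=
    ((div_le_iff₀ (mul_pos hKpos hsρ)).1 hN2).trans_eq (mul_comm _ _)
  refine (H n (sideLength ρ (n + 1)) ε (K * Real.sqrt ρ * sideLength ρ (n + 1)) Ψ hLpos hε hε4
    hMK).trans ?_
  exact tail_cast_bound n hc₀ (mul_nonneg hA (sq_nonneg _))
    (mul_nonneg (mul_nonneg hC.le hρ.le) (Nat.cast_nonneg _)) hT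
    (tail_real_bound hc₁ hC hKpos hKsq hε hε4 hρ hLpos (Nat.cast_nonneg _))

end Summit.AtomisticToContinuum.BoseEinsteinCondensation.Theorems.BecUvTail

end
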